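import Summits.QuantumFields.YangMills.Theorems.BalabanLadderNTReferenceMarginsExplicit
import Summits.QuantumFields.YangMills.Theorems.BalabanLadderNTReferenceMarginsPackage
import Summits.QuantumFields.YangMills.Theorems.BalabanLadderNTUnitNormalForm
import HarnessLib

/-!
# Crux `NT` (stmt-QuantumFields-19353): the periodic reference package in CLOSED FORM — no limit clause, no margins,
# no envelopes: `BalabanLadder.NT` by name from E1/E2/E3-osc and two plain floors against explicit numbers

Helper file (`--supports stmt-QuantumFields-19353`) of the fleet lead prover of crux `NT` (unit `ym-spine-19353-p1`,
g11); capstone of the series `…NTReferenceMargins{,ThreePoint,Package,Explicit}` and `…NTUnitNormalForm`.  The registered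
stub `stub_refpkgT : RefPkgT` (v4T) carries (α) the conjunct `Tendsto a atTop (𝓝 0)`, (β) two floors WITH β-dependent
MARGINS.  By `UnitNormalForm.tendsto_zero_of_q2Floor` (α) is implied by clause 4; by `refMargin₂/₃_le_explicit` the margins
are bounded by closed-form NUMBERS in the witnesses' sup norms `M`, support radius `σ`, time gap / separation `δ` and
the collar `κ`.  Hence:

* **`nt_of_torusReferencePackage_explicit`** — for every compact simple `G` (Borel σ-algebra): ONE `(r, a)` with `0 < a`
  (nothing else asked of the unit), constants `C₁, C₂, C₃ ≥ 0`, a femto scale `ℓ`, a support radius `σ > 0` and a collar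
  `κ > 0` (`2(σ+κ) < ℓ`), the three exterior-oscillation ceilings E1/E2/E3-osc on femto cubes (verbatim the registered
  clauses 1–3), and on ONE torus `L₀(β)` per coupling (`a β · L₀ β ≥ σ + κ + 1`):
    clause 4′: a positive-time witness `v` with `|v| ≤ M`, `tsupport v ⊆ closedBall 0 σ`, time gap `δ` (`v y ≠ 0 → δ ≤ y 0`)
               and **`ε + M²(2σ+3)⁸(2C₁²/κ⁸ + C₂/(κ⁴(2δ)⁴)) ≤ Q2 G r β (L₀ β) (a β) (θv) v`**;
    clause 5′: `f, g, h` with `|f| ≤ M_f`, `|g| ≤ M_g`, `|h| ≤ M_h`, supports in `closedBall 0 σ`, pairwise `δ`-separated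
               (`f p ≠ 0 → g q ≠ 0 → δ ≤ ‖p − q‖`, …) and
               **`ε + M_fM_gM_h(2σ+3)¹²(6C₁C₂/(κ⁸δ⁴) + 2C₁³/κ¹² + C₃/(κ⁴δ⁸)) ≤ |Q3 G r β (L₀ β) (a β) f g h|`**
  ⇒ `BalabanLadder.NT`.

Every datum asked (`M`, `σ`, `δ`) exists for every admissible witness of the registered text (`exists_timeGap_of_tsupport_subset`,
`exists_sep_of_disjoint_tsupport`, boundedness of Schwartz functions), so this is a RE-TYPING of the registered engine bill
with the analysis discharged, not a strengthening of its mathematical content: what the engine must deliver are the three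
ceilings and two floors beating two NUMBERS fixed before `β`.  (Owner's pen whether a re-cut uses it; nothing registered.)

HONEST FRAMING.  Bookkeeping over the tree; every floor and ceiling is engine-grade OPEN (PerturbativeInvisibility); not a
floor, not AF, not NT, not the seam, not the gap; not Clay.
-/

set_option autoImplicit false

noncomputable section

open scoped SchwartzMap
open MeasureTheory Filter Topology Finset
open Literature.MathematicalPhysics.QuantumFieldTheory Literature.MathematicalPhysics.QuantumLattice
open Literature.Probability.LatticeModels
open Summit.QuantumFields.YangMills.Cruxes.OSLegsFromFemtoAndGap.DlrCollarTransfer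
open Summit.QuantumFields.YangMills.Cruxes.NT.UnitNormalForm (tendsto_zero_of_q2Floor)

namespace Summit.QuantumFields.YangMills.Cruxes.NT.Reference

/-- **`BalabanLadder.NT` BY NAME from the periodic reference package in CLOSED FORM** (see the module docstring):
units `0 < a` only; E1/E2/E3-osc; clause 4′ `ε + M²(2σ+3)⁸(2C₁²/κ⁸ + C₂/(κ⁴(2δ)⁴)) ≤ Q2(θv, v)` and clause 5′
`ε + M_fM_gM_h(2σ+3)¹²(6C₁C₂/(κ⁸δ⁴) + 2C₁³/κ¹² + C₃/(κ⁴δ⁸)) ≤ |Q3(f, g, h)|` on one torus per coupling. [folklore] -/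
theorem nt_of_torusReferencePackage_explicit
    (h : ∀ (G : Type) [Group G] [TopologicalSpace G] [IsTopologicalGroup G] [CompactSpace G],
      IsCompactSimpleLieGroup G → letI : MeasurableSpace G := borel G; haveI : BorelSpace G := ⟨rfl⟩;
      ∃ (r : LatticeRep G) (a : ℝ → ℝ), (∀ β, 0 < a β) ∧
      ∃ (C₁ C₂ C₃ ℓ σ κ : ℝ), 0 ≤ C₁ ∧ 0 ≤ C₂ ∧ 0 ≤ C₃ ∧ 0 < σ ∧ 0 < κ ∧ 2 * (σ + κ) < ℓ ∧
      (∃ β₁ : ℝ, ∀ β : ℝ, β₁ ≤ β → ∀ (c : Fin 4 → ℤ) (b : ℕ), (b : ℝ) * a β ≤ ℓ →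
        ∀ (η η' : LGConfig 4 G) (x : Fin 4 → ℤ), 1 ≤ depth c b x →
          |kerE G r β c b η (dens G r x) - kerE G r β c b η' (dens G r x)| ≤ C₁ / (depth c b x : ℝ) ^ 4) ∧
      (∃ β₂ : ℝ, ∀ β : ℝ, β₂ ≤ β → ∀ (c : Fin 4 → ℤ) (b : ℕ), (b : ℝ) * a β ≤ ℓ →
        ∀ (η η' : LGConfig 4 G) (x y : Fin 4 → ℤ), 1 ≤ depth c b x → 1 ≤ depth c b y →
          |kerCov G r β c b η (dens G r x) (dens G r y) - kerCov G r β c b η' (dens G r x) (dens G r y)| ≤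
            C₂ / ((min (depth c b x) (depth c b y) : ℕ) : ℝ) ^ 4 / (1 + ‖siteToE (y - x)‖) ^ 4) ∧
      (∃ β₃ : ℝ, ∀ β : ℝ, β₃ ≤ β → ∀ (c : Fin 4 → ℤ) (b : ℕ), (b : ℝ) * a β ≤ ℓ →
        ∀ (η η' : LGConfig 4 G) (x y z : Fin 4 → ℤ), 1 ≤ depth c b x → 1 ≤ depth c b y → 1 ≤ depth c b z →
          |kerK3 G r β c b η x y z - kerK3 G r β c b η' x y z| ≤
            C₃ / ((min (min (depth c b x) (depth c b y)) (depth c b z) : ℕ) : ℝ) ^ 4 /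
              (1 + min (min ‖siteToE (y - x)‖ ‖siteToE (z - y)‖) ‖siteToE (z - x)‖) ^ 8) ∧
      (∃ (v : 𝓢(EuclideanSpace ℝ (Fin 4), ℝ)) (ε β₅ M δ : ℝ) (L₀ : ℝ → ℕ),
        tsupport (v : EuclideanSpace ℝ (Fin 4) → ℝ) ⊆ {y | 0 < y 0} ∧
        tsupport (v : EuclideanSpace ℝ (Fin 4) → ℝ) ⊆ Metric.closedBall 0 σ ∧ 0 < ε ∧
        (∀ y : EuclideanSpace ℝ (Fin 4), |v y| ≤ M) ∧ 0 < δ ∧ (∀ y : EuclideanSpace ℝ (Fin 4), v y ≠ 0 → δ ≤ y 0) ∧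
        ∀ β : ℝ, β₅ ≤ β → σ + κ + 1 ≤ a β * L₀ β ∧
          ε + M ^ 2 * (2 * σ + 3) ^ 8 * (2 * C₁ ^ 2 / κ ^ 8 + C₂ / (κ ^ 4 * (2 * δ) ^ 4)) ≤
            Q2 G r β (L₀ β) (a β) (thetaTest 4 v) v) ∧
      (∃ (f g h : 𝓢(EuclideanSpace ℝ (Fin 4), ℝ)) (ε β₅ Mf Mg Mh δ : ℝ) (L₀ : ℝ → ℕ),
        Disjoint (tsupport (f : EuclideanSpace ℝ (Fin 4) → ℝ)) (tsupport (g : EuclideanSpace ℝ (Fin 4) → ℝ)) ∧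
        Disjoint (tsupport (g : EuclideanSpace ℝ (Fin 4) → ℝ)) (tsupport (h : EuclideanSpace ℝ (Fin 4) → ℝ)) ∧
        Disjoint (tsupport (f : EuclideanSpace ℝ (Fin 4) → ℝ)) (tsupport (h : EuclideanSpace ℝ (Fin 4) → ℝ)) ∧
        tsupport (f : EuclideanSpace ℝ (Fin 4) → ℝ) ⊆ Metric.closedBall 0 σ ∧
        tsupport (g : EuclideanSpace ℝ (Fin 4) → ℝ) ⊆ Metric.closedBall 0 σ ∧
        tsupport (h : EuclideanSpace ℝ (Fin 4) → ℝ) ⊆ Metric.closedBall 0 σ ∧ 0 < ε ∧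
        (∀ y : EuclideanSpace ℝ (Fin 4), |f y| ≤ Mf) ∧ (∀ y : EuclideanSpace ℝ (Fin 4), |g y| ≤ Mg) ∧
        (∀ y : EuclideanSpace ℝ (Fin 4), |h y| ≤ Mh) ∧ 0 < δ ∧
        (∀ p q : EuclideanSpace ℝ (Fin 4), f p ≠ 0 → g q ≠ 0 → δ ≤ ‖p - q‖) ∧
        (∀ p q : EuclideanSpace ℝ (Fin 4), g p ≠ 0 → h q ≠ 0 → δ ≤ ‖p - q‖) ∧
        (∀ p q : EuclideanSpace ℝ (Fin 4), f p ≠ 0 → h q ≠ 0 → δ ≤ ‖p - q‖) ∧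
        ∀ β : ℝ, β₅ ≤ β → σ + κ + 1 ≤ a β * L₀ β ∧
          ε + Mf * Mg * Mh * (2 * σ + 3) ^ 12 *
              (6 * C₁ * C₂ / (κ ^ 8 * δ ^ 4) + 2 * C₁ ^ 3 / κ ^ 12 + C₃ / (κ ^ 4 * δ ^ 8)) ≤
            |Q3 G r β (L₀ β) (a β) f g h|)) :
    Summit.QuantumFields.YangMills.Theses.BalabanLadder.NT := by
  intro G _ _ _ _ hG
  letI : MeasurableSpace G := borel G
  haveI : BorelSpace G := ⟨rfl⟩
  obtain ⟨r, a, ha₀, C₁, C₂, C₃, ℓ, σ, κ, hC₁, hC₂, hC₃, hσ, hκ, hℓ, hE1, hE2, hE3,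
    ⟨v, ε, β₅, M, δ, L₀, hv, hvσ, hε, hM, hδ, hvδ, hR⟩,
    ⟨f, g, h', ε', β₅', Mf, Mg, Mh, δ', L₀', hfg, hgh, hfh, hfσ, hgσ, hhσ, hε', hMf, hMg, hMh, hδ', h₁, h₂, h₃, hR'⟩⟩ :=
    h G hG
  -- the limit clause from clause 4′ (its threshold is non-negative)
  have hthr : 0 ≤ M ^ 2 * (2 * σ + 3) ^ 8 * (2 * C₁ ^ 2 / κ ^ 8 + C₂ / (κ ^ 4 * (2 * δ) ^ 4)) := by positivity
  have ha : Tendsto a atTop (𝓝 0) := by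
    refine tendsto_zero_of_q2Floor r a ha₀ (thetaTest 4 v) v hε (β₅ := β₅) fun β hβ => ?_
    obtain ⟨hfit, hfl⟩ := hR β hβ
    refine ⟨L₀ β, ?_, le_trans (by linarith) hfl⟩
    by_contra h0
    have hL0 : L₀ β = 0 := by omega
    rw [hL0, Nat.cast_zero, mul_zero] at hfit
    linarith
  -- the closed-form envelopes `K = M (2σ+3)⁴`
  have hM0 : 0 ≤ M := (abs_nonneg _).trans (hM 0)
  have hKθ : ∀ s : ℝ, 0 < s → s ≤ 1 → ∀ Λ : Finset (Fin 4 → ℤ),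
      ∑ x ∈ Λ, |thetaTest 4 v (s • siteToE x)| ≤ M * (2 * σ + 3) ^ 4 / s ^ 4 := fun s hs hs1 Λ =>
    sum_abs_lattice_le_sup_div (abs_thetaTest_le hM) (tsupport_thetaTest_subset_closedBall_zero hvσ) hσ.le hs hs1 Λ
  have hKv : ∀ s : ℝ, 0 < s → s ≤ 1 → ∀ Λ : Finset (Fin 4 → ℤ),
      ∑ y ∈ Λ, |v (s • siteToE y)| ≤ M * (2 * σ + 3) ^ 4 / s ^ 4 := fun s hs hs1 Λ =>
    sum_abs_lattice_le_sup_div hM hvσ hσ.le hs hs1 Λ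
  have hKf : ∀ s : ℝ, 0 < s → s ≤ 1 → ∀ Λ : Finset (Fin 4 → ℤ),
      ∑ x ∈ Λ, |f (s • siteToE x)| ≤ Mf * (2 * σ + 3) ^ 4 / s ^ 4 := fun s hs hs1 Λ =>
    sum_abs_lattice_le_sup_div hMf hfσ hσ.le hs hs1 Λ
  have hKg : ∀ s : ℝ, 0 < s → s ≤ 1 → ∀ Λ : Finset (Fin 4 → ℤ),
      ∑ y ∈ Λ, |g (s • siteToE y)| ≤ Mg * (2 * σ + 3) ^ 4 / s ^ 4 := fun s hs hs1 Λ =>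
    sum_abs_lattice_le_sup_div hMg hgσ hσ.le hs hs1 Λ
  have hKh : ∀ s : ℝ, 0 < s → s ≤ 1 → ∀ Λ : Finset (Fin 4 → ℤ),
      ∑ z ∈ Λ, |h' (s • siteToE z)| ≤ Mh * (2 * σ + 3) ^ 4 / s ^ 4 := fun s hs hs1 Λ =>
    sum_abs_lattice_le_sup_div hMh hhσ hσ.le hs hs1 Λ
  have hMf0 : 0 ≤ Mf := (abs_nonneg _).trans (hMf 0)
  have hMg0 : 0 ≤ Mg := (abs_nonneg _).trans (hMg 0)
  refine ⟨r, a, ha₀, ha,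
    lowerBounds_fst_of_torusReference_plain G r a ha₀ ha hC₁ hC₂ hσ hκ hℓ hE1 hE2
      ⟨v, ε, β₅, δ, M * (2 * σ + 3) ^ 4, M * (2 * σ + 3) ^ 4, L₀, hv, hvσ, hε, hδ, hvδ, by positivity, hKθ, hKv,
        fun β hβ => ⟨(hR β hβ).1, ?_⟩⟩,
    lowerBounds_snd_of_torusReference_plain G r a ha₀ ha hC₁ hC₂ hC₃ hσ hκ hℓ hE1 hE2 hE3
      ⟨f, g, h', ε', β₅', δ', Mf * (2 * σ + 3) ^ 4, Mg * (2 * σ + 3) ^ 4, Mh * (2 * σ + 3) ^ 4, L₀', hfg, hgh, hfh,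
        hfσ, hgσ, hhσ, hε', hδ', h₁, h₂, h₃, by positivity, by positivity, hKf, hKg, hKh,
        fun β hβ => ⟨(hR' β hβ).1, ?_⟩⟩⟩
  · have e : M * (2 * σ + 3) ^ 4 * (M * (2 * σ + 3) ^ 4) = M ^ 2 * (2 * σ + 3) ^ 8 := by ring
    rw [e]; exact (hR β hβ).2
  · have e : Mf * (2 * σ + 3) ^ 4 * (Mg * (2 * σ + 3) ^ 4) * (Mh * (2 * σ + 3) ^ 4) =
        Mf * Mg * Mh * (2 * σ + 3) ^ 12 := by ring
    rw [e]; exact (hR' β hβ).2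

end Summit.QuantumFields.YangMills.Cruxes.NT.Reference

end
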